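import Mathlib
import Summits.NavierStokesRegularity.NavierStokesRegularity.Theorems.EulerZoomLiouvillePowerGaugeEulerLiouvilleDSSHelicity
import HarnessLib

/-!
# Zero helicity of exactly SELF-SIMILAR Euler collapse PROFILES in the power-gauged class
# (helper for the crux `EulerZoomLiouville.PowerGaugeEulerLiouville`, route №10, item stmt-NavierStokesRegularity-19832)

Helper file (theorems only; `--supports stmt-NavierStokesRegularity-19832`). Seat ns-typeII-p3 (cell
ns-regularity-ideate §B, D-0081). Profile form of `…DSSHelicity.lean` (rung C1 of
`Lines/rungC_window.lean`, the exactly self-similar members): if `(u, p)` is a classical Euler flow on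
`(−∞, 0)` of the self-similar form `u(τ,y) = (−τ)^{−m} V((−τ)^{−n}y)`, `p(τ,y) = (−τ)^{−2m} P((−τ)^{−n}y)`,
`m = (1+ρ)/(2+ρ)`, `n = 1/(2+ρ)`, `ρ > 0` (the dictionary of `Lines/rungC_window.lean`), with differentiable
profiles `V`, `P` whose PROFILE densities `⟪V, curl V⟫` and
`F = (|P| + ½|V|²)|curl V| + (‖∇V‖|V| + ‖∇P‖)|V|` are integrable on `ℝ³`, then `∫⟪V, curl V⟫ = 0`
(`helicity_profile_eq_zero_of_selfSimilar`). All hypotheses are met by the natural tails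
`|V| ~ |y|^{−(1+ρ)}`, `|∇V|, |curl V| ~ |y|^{−(2+ρ)}`, `|P| ~ |y|^{−2(1+ρ)}`, `|∇P| ~ |y|^{−(3+2ρ)}`: a kernel
TEST for candidate refuting profiles of the window (next to the CIV 2026 constraints of the route's KILL
TEST). Scaling dictionary (`selfSimilar_helicity_density`, `selfSimilar_flux_density`): at time `τ`, with
`c = (−τ)^{−m}`, `λ = (−τ)^{−n}`: `⟪u, curl u⟫(y) = c²λ ⟪V, curl V⟫(λy)`, `F_u(y) = c³λ F(λy)`.

WHAT THIS IS NOT: not NS, not the crux, not a Liouville theorem — a necessary condition on rung C1's open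
core (CS13 p. 3 remark, here for Seregin's gauged class under natural-tail integrability). [folklore]
-/

noncomputable section

-- the summit and its single problem share the name `NavierStokesRegularity` (D-0017 nested layout)
set_option linter.dupNamespace false

open Set Function Filter Topology MeasureTheory Metric Module
open scoped NNReal ENNReal InnerProductSpace RealInnerProductSpace

namespace Summit.NavierStokesRegularity.NavierStokesRegularity.Theorems.PowerGaugeEulerLiouville.Helicity

open Literature.Analysis Literature.Analysis.FluidPDE
open Summit.NavierStokesRegularity.NavierStokesRegularity.Theorems.PowerGaugeEulerLiouville.AxisymNoSwirl

/-- `‖∇(c · P(λ ·))(y)‖ = |c| |λ| ‖∇P(λ y)‖` for differentiable `P`. [folklore] -/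
theorem norm_gradient_const_mul_comp_smul {P : (EuclideanSpace ℝ (Fin 3)) → ℝ} (hP : Differentiable ℝ P)
    (c lam : ℝ) (y : EuclideanSpace ℝ (Fin 3)) :
    ‖gradient (fun z : EuclideanSpace ℝ (Fin 3) => c * P (lam • z)) y‖ = |c| * |lam| * ‖gradient P (lam • y)‖ := by
  -- `‖∇g‖ = ‖Dg‖` (the Riesz isometry; tree: `LogtimeBernoulli.norm_gradient_eq_norm_fderiv`)
  have hng : ∀ (g : (EuclideanSpace ℝ (Fin 3)) → ℝ) (x : EuclideanSpace ℝ (Fin 3)),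
      ‖gradient g x‖ = ‖fderiv ℝ g x‖ := fun g x => by
    rw [gradient]; exact (InnerProductSpace.toDual ℝ _).symm.norm_map _
  rw [hng, hng]
  have hd : DifferentiableAt ℝ (fun z : EuclideanSpace ℝ (Fin 3) => P (lam • z)) y :=
    (hP (lam • y)).comp y ((differentiableAt_id).const_smul lam)
  have h1 : fderiv ℝ (fun z : EuclideanSpace ℝ (Fin 3) => c * P (lam • z)) y =
      c • fderiv ℝ (fun z : EuclideanSpace ℝ (Fin 3) => P (lam • z)) y := fderiv_const_mul hd c
  rw [h1, fderiv_comp_smul lam, norm_smul, norm_smul, Real.norm_eq_abs, Real.norm_eq_abs, mul_assoc]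

section Profile

variable {ρ : ℝ} {u : ℝ → (EuclideanSpace ℝ (Fin 3)) → (EuclideanSpace ℝ (Fin 3))}
  {p : ℝ → (EuclideanSpace ℝ (Fin 3)) → ℝ}
  {V : (EuclideanSpace ℝ (Fin 3)) → (EuclideanSpace ℝ (Fin 3))} {P : (EuclideanSpace ℝ (Fin 3)) → ℝ}

/-- **Helicity density of a self-similar slice**: `⟪u(τ), curl u(τ)⟫(y) = c²λ ⟪V, curl V⟫(λy)`,
`c = (−τ)^{−m}`, `λ = (−τ)^{−n}`. [folklore] -/
theorem selfSimilar_helicity_density (hV : Differentiable ℝ V)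
    (hu : ∀ τ : ℝ, τ < 0 → ∀ y : (EuclideanSpace ℝ (Fin 3)),
      u τ y = ((-τ) ^ (-((1 + ρ) / (2 + ρ)))) • V (((-τ) ^ (-(1 / (2 + ρ)))) • y))
    {τ : ℝ} (hτ : τ < 0) (y : EuclideanSpace ℝ (Fin 3)) :
    ⟪u τ y, curl (u τ) y⟫ = ((-τ) ^ (-((1 + ρ) / (2 + ρ)))) ^ 2 * (-τ) ^ (-(1 / (2 + ρ))) *
      ⟪V (((-τ) ^ (-(1 / (2 + ρ)))) • y), curl V (((-τ) ^ (-(1 / (2 + ρ)))) • y)⟫ := by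
  have hfun : u τ = fun z => ((-τ) ^ (-((1 + ρ) / (2 + ρ)))) • V (((-τ) ^ (-(1 / (2 + ρ)))) • z) :=
    funext fun z => hu τ hτ z
  rw [hfun, curl_smul_comp_smul hV, inner_smul_left, inner_smul_right]
  simp only [conj_trivial]
  ring

/-- **Flux density of a self-similar slice**: `F_u(τ, y) = c³λ F_V(λy)`. [folklore] -/
theorem selfSimilar_flux_density (hV : Differentiable ℝ V) (hP : Differentiable ℝ P)
    (hu : ∀ τ : ℝ, τ < 0 → ∀ y : (EuclideanSpace ℝ (Fin 3)),
      u τ y = ((-τ) ^ (-((1 + ρ) / (2 + ρ)))) • V (((-τ) ^ (-(1 / (2 + ρ)))) • y))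
    (hp : ∀ τ : ℝ, τ < 0 → ∀ y : (EuclideanSpace ℝ (Fin 3)),
      p τ y = ((-τ) ^ (-(2 * (1 + ρ) / (2 + ρ)))) * P (((-τ) ^ (-(1 / (2 + ρ)))) • y))
    {τ : ℝ} (hτ : τ < 0) (y : EuclideanSpace ℝ (Fin 3)) :
    (|p τ y| + ‖u τ y‖ ^ 2 / 2) * ‖curl (u τ) y‖ +
        (‖fderiv ℝ (u τ) y‖ * ‖u τ y‖ + ‖gradient (p τ) y‖) * ‖u τ y‖ =
      ((-τ) ^ (-((1 + ρ) / (2 + ρ)))) ^ 3 * (-τ) ^ (-(1 / (2 + ρ))) *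
        ((|P (((-τ) ^ (-(1 / (2 + ρ)))) • y)| + ‖V (((-τ) ^ (-(1 / (2 + ρ)))) • y)‖ ^ 2 / 2) *
            ‖curl V (((-τ) ^ (-(1 / (2 + ρ)))) • y)‖ +
          (‖fderiv ℝ V (((-τ) ^ (-(1 / (2 + ρ)))) • y)‖ * ‖V (((-τ) ^ (-(1 / (2 + ρ)))) • y)‖ +
            ‖gradient P (((-τ) ^ (-(1 / (2 + ρ)))) • y)‖) * ‖V (((-τ) ^ (-(1 / (2 + ρ)))) • y)‖) := by
  have hτ' : 0 < -τ := by linarith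
  set c : ℝ := (-τ) ^ (-((1 + ρ) / (2 + ρ))) with hc
  set lam : ℝ := (-τ) ^ (-(1 / (2 + ρ))) with hlam
  have hc0 : 0 < c := Real.rpow_pos_of_pos hτ' _
  have hlam0 : 0 < lam := Real.rpow_pos_of_pos hτ' _
  have hc2 : (-τ) ^ (-(2 * (1 + ρ) / (2 + ρ))) = c ^ 2 := by
    rw [hc, ← Real.rpow_natCast ((-τ) ^ (-((1 + ρ) / (2 + ρ)))) 2, ← Real.rpow_mul hτ'.le]
    congr 1; push_cast; ring
  have hfun : u τ = fun z => c • V (lam • z) := funext fun z => hu τ hτ z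
  have hpfun : p τ = fun z => c ^ 2 * P (lam • z) := funext fun z => by rw [hp τ hτ z, hc2]
  have h1 : ‖u τ y‖ = c * ‖V (lam • y)‖ := by
    rw [hu τ hτ y, norm_smul, Real.norm_of_nonneg hc0.le]
  have h2 : ‖curl (u τ) y‖ = c * lam * ‖curl V (lam • y)‖ := by
    rw [hfun, curl_smul_comp_smul hV, norm_smul, Real.norm_of_nonneg (by positivity)]
  have h3 : ‖fderiv ℝ (u τ) y‖ = c * lam * ‖fderiv ℝ V (lam • y)‖ := by
    rw [hfun, fderiv_smul_comp_smul c lam (hV _), norm_smul, Real.norm_of_nonneg (by positivity)]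
  have h4 : |p τ y| = c ^ 2 * |P (lam • y)| := by
    rw [hp τ hτ y, hc2, abs_mul, abs_of_pos (by positivity)]
  have h5 : ‖gradient (p τ) y‖ = c ^ 2 * lam * ‖gradient P (lam • y)‖ := by
    rw [hpfun, norm_gradient_const_mul_comp_smul hP, abs_of_pos (by positivity), abs_of_pos hlam0]
  rw [h1, h2, h3, h4, h5]
  ring

/-- **Zero helicity of self-similar Euler collapse profiles.** [folklore] -/
theorem helicity_profile_eq_zero_of_selfSimilar (hρ : 0 < ρ)
    (hns : IsClassicalNSSolutionOn (Iio 0) 0 0 u p)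
    (hV : Differentiable ℝ V) (hP : Differentiable ℝ P)
    (hu : ∀ τ : ℝ, τ < 0 → ∀ y : (EuclideanSpace ℝ (Fin 3)),
      u τ y = ((-τ) ^ (-((1 + ρ) / (2 + ρ)))) • V (((-τ) ^ (-(1 / (2 + ρ)))) • y))
    (hp : ∀ τ : ℝ, τ < 0 → ∀ y : (EuclideanSpace ℝ (Fin 3)),
      p τ y = ((-τ) ^ (-(2 * (1 + ρ) / (2 + ρ)))) * P (((-τ) ^ (-(1 / (2 + ρ)))) • y))
    (hH : Integrable (fun y => ⟪V y, curl V y⟫))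
    (hF : Integrable (fun y => (|P y| + ‖V y‖ ^ 2 / 2) * ‖curl V y‖ +
      (‖fderiv ℝ V y‖ * ‖V y‖ + ‖gradient P y‖) * ‖V y‖)) :
    ∫ y, ⟪V y, curl V y⟫ = 0 := by
  -- the flow is DSS with factor `2` (as in the tree's `AxisymNoSwirl.dss_of_selfSimilar`, restated inline to
  -- keep this file off the route cone)
  have hdss : ∀ τ : ℝ, τ < 0 → ∀ y, u τ y = ((2 : ℝ) ^ (1 + ρ)) • u (((2 : ℝ) ^ (2 + ρ)) * τ) ((2 : ℝ) • y) := by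
    intro τ hτ y
    have hl : (0 : ℝ) < 2 := by norm_num
    have hL : (0 : ℝ) < 2 ^ (2 + ρ) := Real.rpow_pos_of_pos hl _
    have hτ' : (2 : ℝ) ^ (2 + ρ) * τ < 0 := mul_neg_of_pos_of_neg hL hτ
    rw [hu τ hτ y, hu _ hτ' ((2 : ℝ) • y), smul_smul, smul_smul]
    have hneg : -((2 : ℝ) ^ (2 + ρ) * τ) = 2 ^ (2 + ρ) * (-τ) := by ring
    have hτ0 : 0 < -τ := by linarith
    have hamp : (2 : ℝ) ^ (1 + ρ) * ((2 : ℝ) ^ (2 + ρ) * -τ) ^ (-((1 + ρ) / (2 + ρ))) =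
        (-τ) ^ (-((1 + ρ) / (2 + ρ))) := by
      rw [Real.mul_rpow hL.le hτ0.le, ← Real.rpow_mul hl.le]
      have : (2 + ρ) * -((1 + ρ) / (2 + ρ)) = -(1 + ρ) := by field_simp
      rw [this, ← mul_assoc, ← Real.rpow_add hl]
      simp
    have hlen : ((2 : ℝ) ^ (2 + ρ) * -τ) ^ (-(1 / (2 + ρ))) * 2 = (-τ) ^ (-(1 / (2 + ρ))) := by
      rw [Real.mul_rpow hL.le hτ0.le, ← Real.rpow_mul hl.le]
      have : (2 + ρ) * -(1 / (2 + ρ)) = -1 := by field_simp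
      rw [this, mul_comm, ← mul_assoc, Real.rpow_neg_one, mul_inv_cancel₀ hl.ne', one_mul]
    rw [hneg, hamp, hlen]
  -- integrability of the slice densities and a bound on compact time intervals
  have hint : ∀ s t : ℝ, s < t → t < 0 → ∃ N : ℝ, ∀ τ ∈ Icc s t,
      Integrable (fun x => ⟪u τ x, curl (u τ) x⟫) ∧
      Integrable (fun x => (|p τ x| + ‖u τ x‖ ^ 2 / 2) * ‖curl (u τ) x‖ +
        (‖fderiv ℝ (u τ) x‖ * ‖u τ x‖ + ‖gradient (p τ) x‖) * ‖u τ x‖) ∧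
      ∫ x, ((|p τ x| + ‖u τ x‖ ^ 2 / 2) * ‖curl (u τ) x‖ +
        (‖fderiv ℝ (u τ) x‖ * ‖u τ x‖ + ‖gradient (p τ) x‖) * ‖u τ x‖) ≤ N := by
    intro s t hst ht
    -- the factor `c(τ)³ λ(τ) |λ(τ)³|⁻¹` is continuous on `[s, t]`, hence bounded
    set f : ℝ → ℝ := fun τ => ((-τ) ^ (-((1 + ρ) / (2 + ρ)))) ^ 3 * (-τ) ^ (-(1 / (2 + ρ))) *
      |(((-τ) ^ (-(1 / (2 + ρ)))) ^ 3)⁻¹| with hf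
    have hfc : ContinuousOn f (Icc s t) := by
      have hneg : ∀ τ ∈ Icc s t, (-τ) ≠ 0 := fun τ hτ => by have := hτ.2; linarith
      have hb : ContinuousOn (fun τ : ℝ => -τ) (Icc s t) := continuousOn_neg
      have hc1 : ContinuousOn (fun τ : ℝ => (-τ) ^ (-((1 + ρ) / (2 + ρ)))) (Icc s t) :=
        hb.rpow_const fun τ hτ => Or.inl (hneg τ hτ)
      have hc2 : ContinuousOn (fun τ : ℝ => (-τ) ^ (-(1 / (2 + ρ)))) (Icc s t) :=
        hb.rpow_const fun τ hτ => Or.inl (hneg τ hτ)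
      refine ((hc1.pow 3).mul hc2).mul ((hc2.pow 3).inv₀ fun τ hτ => ?_).abs
      exact pow_ne_zero 3 (Real.rpow_pos_of_pos (by have := hτ.2; linarith) _).ne'
    obtain ⟨M, hM⟩ := isCompact_Icc.exists_bound_of_continuousOn hfc
    refine ⟨M * ∫ y, ((|P y| + ‖V y‖ ^ 2 / 2) * ‖curl V y‖ +
      (‖fderiv ℝ V y‖ * ‖V y‖ + ‖gradient P y‖) * ‖V y‖), fun τ hτ => ?_⟩
    have hτ0 : τ < 0 := hτ.2.trans_lt ht
    have hτ' : 0 < -τ := by linarith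
    have hlam0 : (-τ) ^ (-(1 / (2 + ρ))) ≠ 0 := (Real.rpow_pos_of_pos hτ' _).ne'
    refine ⟨?_, ?_, ?_⟩
    · have h := (hH.comp_smul hlam0).const_mul
        (((-τ) ^ (-((1 + ρ) / (2 + ρ)))) ^ 2 * (-τ) ^ (-(1 / (2 + ρ))))
      exact h.congr (Eventually.of_forall fun y => (selfSimilar_helicity_density hV hu hτ0 y).symm)
    · have h := (hF.comp_smul hlam0).const_mul
        (((-τ) ^ (-((1 + ρ) / (2 + ρ)))) ^ 3 * (-τ) ^ (-(1 / (2 + ρ))))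
      exact h.congr (Eventually.of_forall fun y => (selfSimilar_flux_density hV hP hu hp hτ0 y).symm)
    · rw [integral_congr_ae (Eventually.of_forall fun y => selfSimilar_flux_density hV hP hu hp hτ0 y),
        integral_const_mul, Measure.integral_comp_smul volume (fun z : EuclideanSpace ℝ (Fin 3) =>
          (|P z| + ‖V z‖ ^ 2 / 2) * ‖curl V z‖ + (‖fderiv ℝ V z‖ * ‖V z‖ + ‖gradient P z‖) * ‖V z‖),
        finrank_euclideanSpace_fin, smul_eq_mul, ← mul_assoc]
      have hI0 : 0 ≤ ∫ y, ((|P y| + ‖V y‖ ^ 2 / 2) * ‖curl V y‖ +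
          (‖fderiv ℝ V y‖ * ‖V y‖ + ‖gradient P y‖) * ‖V y‖) :=
        integral_nonneg fun y => by positivity
      have hfτ : f τ ≤ M := (le_abs_self _).trans (by simpa [Real.norm_eq_abs] using hM τ hτ)
      exact mul_le_mul_of_nonneg_right (by rw [hf] at hfτ; exact hfτ) hI0
  -- zero helicity of the flow at `τ = -1`, where the slice is the profile
  have h := helicity_eq_zero_of_dss hρ hns (by norm_num : (1 : ℝ) < 2) hdss hint (by norm_num : (-1 : ℝ) < 0)
  have hslice : u (-1) = V := by
    funext y
    have e := hu (-1) (by norm_num) y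
    simp only [neg_neg, Real.one_rpow, one_smul] at e
    exact e
  rw [hslice] at h
  exact h

end Profile

end Summit.NavierStokesRegularity.NavierStokesRegularity.Theorems.PowerGaugeEulerLiouville.Helicity

end
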